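import Literature.Probability.RandomPlanarGeometry.KlebanZagierTheorem2
import Literature.Probability.RandomPlanarGeometry.CardyFunctionIncBeta
import Mathlib.Analysis.Complex.HasPrimitives
import HarnessLib

/-!
# Stub `stub_kzPrimitive` of line `birth`, crux `CardyWickAnisotropy.AnisotropicBoxCardy`
(stmt-CriticalPhenomena-14309): the Cardy side `r ↦ Π_h(r) = F(λ(ir))` is the restriction to the
positive imaginary axis of a function holomorphic on the upper half-plane — GIVEN that holomorphic
functions on `ℍ` have primitives (the neighbouring stub `stub_halfPlanePrimitive`, taken here as the
hypothesis of the registered implication).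

Kleban–Zagier 2003 §3: `Φ′ = (cardyConst/3)·λ′·ρ^{-2/3}` with `ρ = λ(1-λ) = θ₂⁴θ₄⁴/θ₃⁸` zero-free on
`ℍ`, `ρ^{-2/3} := exp (-(2/3) L)`, `L` a holomorphic primitive of `v = ρ′/ρ` with `L(i) = log ρ(i)` (so
`L(it) = log ρ(it)` on the axis: both have derivative `i v(it)`), `Φ` the primitive normalised by
`Φ(i) = F(λ(i))`; on the axis `t ↦ Φ(it)` and `t ↦ F(λ(it))` have the same derivative
`-(cardyConst/3) π λ θ₄⁴ ρ^{-2/3} (it)` (Cardy's ODE `F′(η) = (cardyConst/3)(η(1-η))^{-2/3}`,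
`(d/dt)λ(it) = -πλθ₄⁴(it)`) and agree at `t = 1`, hence everywhere on `(0, ∞)`.

The registered signature is the NAME `Sig.stub_kzPrimitive` of the (non-importable) line skeleton; it is
restated here verbatim-unfolded as `Sig.stub_kzPrimitive` (a `def … : Prop`, asserted nowhere), next to
the def-free form `kzPrimitive_of_halfPlanePrimitive`.
-/

noncomputable section

open Complex Filter Topology Set

open scoped Real

open Literature.Probability.RandomPlanarGeometry
  Literature.Probability.RandomPlanarGeometry.KlebanZagier
  Literature.NumberTheory.EllipticCurves.JacobiThetaNull

namespace Summit.CriticalPhenomena.CardyFormulaZ2.Theorems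

/-- A path `D : ℝ → ℂ` with zero derivative on `(0, ∞)` and `D 1 = 0` vanishes on `(0, ∞)`. -/
private theorem eq_zero_of_hasDerivAt_zero {D : ℝ → ℂ} (hD : ∀ s : ℝ, 0 < s → HasDerivAt D 0 s)
    (h1 : D 1 = 0) {t : ℝ} (ht : 0 < t) : D t = 0 := by
  have hdiff : DifferentiableOn ℝ D (Set.Ioi 0) := fun s hs =>
    (hD s hs).differentiableAt.differentiableWithinAt
  have hder0 : Set.EqOn (deriv D) 0 (Set.Ioi 0) := fun s hs => (hD s hs).deriv
  have key := isOpen_Ioi.is_const_of_deriv_eq_zero (convex_Ioi (0 : ℝ)).isPreconnected hdiff hder0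
    ht (Set.mem_Ioi.mpr one_pos)
  rw [key, h1]

/-- On the axis a holomorphic primitive `L` of `v = ρ′/ρ` with `L(i) = log ρ(i)` is `log ρ(it)`:
both `t ↦ L(it)` and `t ↦ log ρ(it)` have derivative `i v(it)` (which is real). -/
private theorem axis_log {L : ℂ → ℂ} (hL : ∀ τ : ℂ, 0 < τ.im → HasDerivAt L (vLam τ) τ)
    (hL1 : L I = (Real.log (rhoR 1) : ℂ)) {t : ℝ} (ht : 0 < t) :
    L (I * t) = (Real.log (rhoR t) : ℂ) := by
  set D : ℝ → ℂ := fun s => L (I * s) - (Real.log (rhoR s) : ℂ) with hD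
  have hderiv : ∀ s : ℝ, 0 < s → HasDerivAt D 0 s := by
    intro s hs
    have him : 0 < im (I * s : ℂ) := by simpa using hs
    obtain ⟨hR, hvreal⟩ := hasDerivAt_rhoR hs
    have hRpos : 0 < rhoR s := rhoC_I_mul_re_pos hs
    have hc : HasDerivAt (L ∘ fun s : ℝ => (I * s : ℂ)) (vLam (I * s) * I) s :=
      HasDerivAt.comp s (by exact hL _ him) (hasDerivAt_I_mul s)
    have hlog : HasDerivAt (fun s => Real.log (rhoR s)) ((I * vLam (I * s)).re) s := by
      refine (hR.log hRpos.ne').congr_deriv ?_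
      rw [mul_div_cancel_left₀ _ hRpos.ne']
    have hsub : HasDerivAt D (vLam (I * s) * I - (((I * vLam (I * s)).re : ℝ) : ℂ)) s :=
      hc.sub hlog.ofReal_comp
    refine hsub.congr_deriv ?_
    have hv : (((I * vLam (I * s)).re : ℝ) : ℂ) = I * vLam (I * s) := by
      conv_rhs => rw [← Complex.re_add_im (I * vLam (I * s)), hvreal]
      simp
    rw [hv]
    ring
  have h1 : D 1 = 0 := by
    simp only [hD, Complex.ofReal_one, mul_one, hL1, sub_self]
  have h := eq_zero_of_hasDerivAt_zero hderiv h1 ht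
  exact sub_eq_zero.mp h

/-- On the axis, a holomorphic primitive `Φ` of `(c/3) λ′ exp(-(2/3) L)` (with `L` as in `axis_log`)
normalised by `Φ(i) = F(λ(i))` equals `F(λ(it))`: both solve the same real ODE. -/
private theorem axis_eq {L Φ : ℂ → ℂ} (hL : ∀ τ : ℂ, 0 < τ.im → HasDerivAt L (vLam τ) τ)
    (hL1 : L I = (Real.log (rhoR 1) : ℂ))
    (hΦ : ∀ τ : ℂ, 0 < τ.im → HasDerivAt Φ
      ((cardyConst / 3 : ℂ) * (lamC τ * (π * I * theta4 τ ^ 4)) * cexp (-(2 / 3 : ℂ) * L τ)) τ)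
    (hΦ1 : Φ I = (cardyFunction (lamR 1) : ℂ)) {t : ℝ} (ht : 0 < t) :
    Φ (I * t) = (cardyFunction (lamR t) : ℂ) := by
  set D : ℝ → ℂ := fun s => Φ (I * s) - (cardyFunction (lamR s) : ℂ) with hD
  have hderiv : ∀ s : ℝ, 0 < s → HasDerivAt D 0 s := by
    intro s hs
    have him : 0 < im (I * s : ℂ) := by simpa using hs
    have hRpos : 0 < rhoR s := rhoC_I_mul_re_pos hs
    have hφ : HasDerivAt (Φ ∘ fun s : ℝ => (I * s : ℂ))
        ((cardyConst / 3 : ℂ) * (lamC (I * s) * (π * I * theta4 (I * s) ^ 4)) *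
          cexp (-(2 / 3 : ℂ) * L (I * s)) * I) s :=
      HasDerivAt.comp s (by exact hΦ _ him) (hasDerivAt_I_mul s)
    have hψ : HasDerivAt (fun s : ℝ => (cardyFunction (lamR s) : ℂ))
        (((cardyConst / 3 * (lamR s * (1 - lamR s)) ^ (-(2 / 3 : ℝ)) *
          -(π * lamR s * (theta4 (I * s)).re ^ 4) : ℝ) : ℂ)) s := by
      have h := HasDerivAt.comp s (hasDerivAt_cardyFunction_holds (lamR_mem_Ioo hs))
        (hasDerivAt_lamR hs)
      exact h.ofReal_comp
    have hsub := hφ.sub hψ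
    refine hsub.congr_deriv ?_
    have hexp : cexp (-(2 / 3 : ℂ) * L (I * s)) = ((rhoR s ^ (-(2 / 3 : ℝ)) : ℝ) : ℂ) := by
      rw [axis_log hL hL1 hs, Real.rpow_def_of_pos hRpos, Complex.ofReal_exp]
      congr 1
      push_cast
      ring
    rw [← rhoR_eq hs, hexp, lamC_I_mul hs, theta4_I_mul_eq_re hs]
    simp only [Complex.ofReal_re]
    set P : ℝ := rhoR s ^ (-(2 / 3 : ℝ)) with hP
    set θ : ℝ := (theta4 (I * s)).re with hθ
    push_cast
    linear_combination ((cardyConst : ℂ) / 3 * (lamR s : ℂ) * (π : ℂ) * (θ : ℂ) ^ 4 * (P : ℂ)) * I_sq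
  have h1 : D 1 = 0 := by
    simp only [hD, Complex.ofReal_one, mul_one, hΦ1, sub_self]
  have h := eq_zero_of_hasDerivAt_zero hderiv h1 ht
  exact sub_eq_zero.mp h

/-- The registered signature `Sig.stub_kzPrimitive` of the line skeleton
(`Cruxes/AnisotropicBoxCardy/Lines/birth.lean`, namespace `…Cruxes.AnisotropicBoxCardy.Birth`, not an
importable module), restated VERBATIM in unfolded form: the named implication
`Sig.stub_halfPlanePrimitive → Sig.kzPrimitive` (primitives on `ℍ` ⟹ the Kleban–Zagier primitive).
A statement only — it is the type of `stub_kzPrimitive` below and is asserted nowhere. -/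
def Sig.stub_kzPrimitive : Prop :=
  (∀ f : ℂ → ℂ, DifferentiableOn ℂ f {τ : ℂ | 0 < τ.im} →
      ∃ g : ℂ → ℂ, ∀ τ : ℂ, 0 < τ.im → HasDerivAt g (f τ) τ) →
    (let PiH : ℝ → ℝ := fun r ↦ Literature.Probability.RandomPlanarGeometry.cardyFunction (((Literature.NumberTheory.EllipticCurves.JacobiThetaNull.theta2 (Complex.I * (r : ℂ)) / Literature.NumberTheory.EllipticCurves.JacobiThetaNull.theta3 (Complex.I * (r : ℂ))) ^ 4).re); ∃ Φ : ℂ → ℂ, DifferentiableOn ℂ Φ {τ : ℂ | 0 < τ.im} ∧ ∀ r : ℝ, 0 < r → Φ (Complex.I * (r : ℂ)) = ((PiH r : ℝ) : ℂ))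

/-- **Stub `stub_kzPrimitive`, unfolded form** (line `birth` of crux `AnisotropicBoxCardy`): if
holomorphic functions on `ℍ` have primitives, then there is `Φ` holomorphic on `ℍ` with
`Φ (i r) = Π_h (r)` for all `r > 0`, `Π_h r = cardyFunction (((θ₂/θ₃)(i r))⁴.re)`.
Kleban–Zagier 2003 §3: `Φ′ = (cardyConst/3)·λ′·exp(-(2/3) L)`, `L′ = v = ρ′/ρ`, matched with
`F(λ(it))` on the axis through Cardy's ODE `F′(η) = (cardyConst/3)(η(1-η))^{-2/3}`. -/
theorem kzPrimitive_of_halfPlanePrimitive :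
    (∀ f : ℂ → ℂ, DifferentiableOn ℂ f {τ : ℂ | 0 < τ.im} →
      ∃ g : ℂ → ℂ, ∀ τ : ℂ, 0 < τ.im → HasDerivAt g (f τ) τ) →
    (let PiH : ℝ → ℝ := fun r ↦ Literature.Probability.RandomPlanarGeometry.cardyFunction (((Literature.NumberTheory.EllipticCurves.JacobiThetaNull.theta2 (Complex.I * (r : ℂ)) / Literature.NumberTheory.EllipticCurves.JacobiThetaNull.theta3 (Complex.I * (r : ℂ))) ^ 4).re); ∃ Φ : ℂ → ℂ, DifferentiableOn ℂ Φ {τ : ℂ | 0 < τ.im} ∧ ∀ r : ℝ, 0 < r → Φ (Complex.I * (r : ℂ)) = ((PiH r : ℝ) : ℂ)) := by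
  intro hPrim
  dsimp only
  -- a holomorphic logarithm `L` of `ρ = λ(1-λ)` on `ℍ`, normalised at `i`
  obtain ⟨L₀, hL₀⟩ := hPrim vLam fun τ hτ => (differentiableAt_vLam hτ).differentiableWithinAt
  obtain ⟨L, hL, hL1⟩ : ∃ L : ℂ → ℂ, (∀ τ : ℂ, 0 < τ.im → HasDerivAt L (vLam τ) τ) ∧
      L I = (Real.log (rhoR 1) : ℂ) :=
    ⟨fun τ => L₀ τ - L₀ I + (Real.log (rhoR 1) : ℂ),
      fun τ hτ => ((hL₀ τ hτ).sub_const _).add_const _, by simp⟩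
  -- the integrand `(c/3) λ′ ρ^{-2/3}` and its primitive, normalised at `i`
  have hfd : DifferentiableOn ℂ (fun τ => (cardyConst / 3 : ℂ) * (lamC τ * (π * I * theta4 τ ^ 4)) *
      cexp (-(2 / 3 : ℂ) * L τ)) {τ : ℂ | 0 < τ.im} := by
    intro τ hτ
    have hτ' : 0 < τ.im := hτ
    exact ((((hasDerivAt_lamC hτ').differentiableAt.fun_mul
      (((differentiableAt_theta4 hτ').fun_pow 4).const_mul (π * I))).const_mul _).fun_mul
      ((hL τ hτ').differentiableAt.const_mul _).cexp).differentiableWithinAt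
  obtain ⟨Φ₀, hΦ₀⟩ := hPrim _ hfd
  obtain ⟨Φ, hΦ, hΦ1⟩ : ∃ Φ : ℂ → ℂ, (∀ τ : ℂ, 0 < τ.im → HasDerivAt Φ
      ((cardyConst / 3 : ℂ) * (lamC τ * (π * I * theta4 τ ^ 4)) * cexp (-(2 / 3 : ℂ) * L τ)) τ) ∧
      Φ I = (cardyFunction (lamR 1) : ℂ) :=
    ⟨fun τ => Φ₀ τ - Φ₀ I + (cardyFunction (lamR 1) : ℂ),
      fun τ hτ => ((hΦ₀ τ hτ).sub_const _).add_const _, by simp⟩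
  refine ⟨Φ, fun τ hτ => (hΦ τ hτ).differentiableAt.differentiableWithinAt, fun r hr => ?_⟩
  rw [axis_eq hL hL1 hΦ hΦ1 hr, div_pow, ← lamC, lamC_I_mul hr, Complex.ofReal_re]

/-- **Stub `stub_kzPrimitive`** (line `birth` of crux `AnisotropicBoxCardy`, registered signature
`Sig.stub_kzPrimitive := Sig.stub_halfPlanePrimitive → Sig.kzPrimitive`): GIVEN primitives on `ℍ`, the
Cardy side `r ↦ Π_h(r)` is the axis restriction of a function holomorphic on `ℍ`. -/
theorem stub_kzPrimitive : Sig.stub_kzPrimitive :=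
  kzPrimitive_of_halfPlanePrimitive

end Summit.CriticalPhenomena.CardyFormulaZ2.Theorems

end
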